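import Mathlib.GroupTheory.Index
import Mathlib.GroupTheory.OrderOfElement
import Mathlib.GroupTheory.QuotientGroup.Basic
import Mathlib.Algebra.Group.Pi.Lemmas
import Mathlib.Algebra.Order.Group.Abs
import Mathlib.Data.Finset.Max
import Mathlib.Data.Nat.Factorial.Basic
import Mathlib.Tactic.Group
import Mathlib.Tactic.Abel
import Mathlib.Tactic.LinearCombination
import Mathlib.Tactic.Ring
import HarnessLib

/-!
# ONE-LAMP NO-GO: the orbit theorem's exact-step condition (`hstep` of «AutChartOrbitsCayleyCosets») is UNSATISFIABLE on a Cayley graph whose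
# generating set has ONE lamp letter and otherwise torsion tree letters — for EVERY finite-index subgroup, transversal, character and scale

builds on p205010 (kernel theorem, internal audit signed; external expert review pending) — nothing in this file uses p205010: it is a NEGATIVE (scope)
record about the HYPOTHESES of the orbit theorem (N3-a), pure group theory / combinatorics, no percolation statement.  Lane `prim-bschramm`, seat
`prim-bschramm-p3` gen 35 (DESIGN OWNER; `run/shared/lean/prim/bschramm/P3-NILPOTENT.md` §28).  Helper file (`--supports stmt-CriticalPhenomena-4575 --as helper`).
Def-free.  NOTHING is claimed about any `@[conjecture]` node; in particular nothing about `BenjaminiSchramm1996_conj4_endState`.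

THE POINT.  `CayleyCosets.conj4_of_cosetLetters` («AutChartOrbitsCayleyCosets» p580600) proves Conjecture 4 on `Cay(Γ; S)` from a subgroup `Γ₀ ≤ Γ`, a finite
right transversal `R`, a homomorphism `c : Γ₀ → ℤ²` and a scale `N ≥ 1` such that at every representative `r` all four exact axis values `± N eᵢ` occur as `c a`
for letters `x ∈ S ∪ S⁻¹` with `r·x = a·r′` (`hstep`).  `P3-NILPOTENT.md` §26.6–26.7 asked whether such a DESIGNED TRANSVERSAL exists for Bartholdi–Erschler's
`Γ₂ = ℤ ≀_X 𝔊` with its STANDARD generating set `{a, b, c, d, s}` (one lamp letter `s`), proved it impossible at relative unit scale and searched a grid of deeper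
designs (all UNSAT, census j292224) — 'not a theorem about all configurations'.  THIS FILE PROVES IT FOR ALL CONFIGURATIONS, abstractly:
* §1 `OneLampNoGo.no_four_directions` — the combinatorial core.  On a finite non-empty set `Q` with functions `h, m : Q → ℤ²` ('heights' and 'lamp
  weights') and two maps `s⁺, s⁻ : Q → Q`, it is impossible that at every `q` each of the four vectors `± N e₀, ± N e₁` (`N ≥ 1`) is of the form
  `h q′ − h q` (a ZERO-DRIFT slot) or `m q + (h (s⁺ q) − h q)` (the forward LAMP slot) or `−m q + (h (s⁻ q) − h q)` (the backward lamp slot).  Proof: at a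
  maximiser `q` of `h₀` the value `+N e₀` can only come from a lamp slot, which pins `|`first coordinate`| ≥ N` on BOTH lamp slots; so `+N e₁` comes from a
  zero-drift slot `h q′ − h q = N e₁`, and `q′` is again a maximiser of `h₀` with `h₁` raised by `N` — absurd at a maximiser of `h₁` among the maximisers of `h₀`.
* §2 `OneLampNoGo.not_cosetSteps` — the group-theoretic reduction.  `Γ` a group, `A ⊴ Γ` abelian, `H ≤ Γ` TORSION with `A ⊓ H = ⊥` and a decomposition
  `γ = lam γ · tr γ` (`lam γ ∈ A`, `tr γ ∈ H`); letters: a finite set `S` every member of which is a tree letter (`∈ H`) or THE one lamp letter `s ∈ A`.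
  Then for every finite-index `Γ₀ ≤ Γ`, every finite right transversal `R`, every `c : Γ₀ →* ℤ²` and every `N ≥ 1` the letter-form step condition `hstep`
  of `conj4_of_cosetLetters` for `S` FAILS (`decomp_unique`, `pow_factorial_index_mem` are the two elementary lemmas it rests on).  Reduction: with `K := (index Γ₀)!` every `γ^K ∈ Γ₀`; `C γ := c(γ^K)` is additive on `A` and `Γ₀`-conjugation invariant;
  `α ↦ C(lam α)` is a homomorphism on `Γ₀` that agrees with `K·c` on `Γ₀ ∩ A`, hence everywhere (the difference dies on `Γ₀ ∩ A` and `Γ₀/(Γ₀ ∩ A)` is torsion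
  because `H` is); so with `h r := −C(lam r)` and `m r := C(r s r⁻¹)` the values `K · c a` of tree letters are `h r′ − h r` and of `s^{±1}` are `± m r + (h r′ − h r)`
  — §1 with scale `K N`.
CUSTOMER (by the seat's companion file «GrigorchukLamplighterStandardGensNoGo», conditional on Grigorchuk's torsion theorem as a named hypothesis):
`Γ = Grigorchuk.wreathZ = ℤ ≀_X 𝔊`, `A` = the lamp configurations, `H` = the tree part `≅ 𝔊`, `T = {a, b, c, d}`, `s = (ρ ↦ 1)`: the (N3-a) door is CLOSED BY
PROOF for Bartholdi–Erschler's standard generating set and EVERY finite-index subgroup of `Γ₂` acting by left multiplication (caveat (α) of §26.5 —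
subgroups of `Aut(Cay)` not inside `Γ₂` — untouched).  The Lipschitz condition `hlip` is not even used.
[cite: BenjaminiSchramm1996, Conj. 4; §2 (Cayley graphs)] [cite: BartholdiErschler2012, §2 (permutational wreath products, standard generating set)]
-/

namespace Summit.CriticalPhenomena.PercolationContinuityZ3.Theorems.Transplant

namespace OneLampNoGo

/-! ## §1 The combinatorial core: four exact directions cannot be served by zero-drift slots and ONE lamp letter -/

/-- **ONE-LAMP NO-GO (combinatorial core).**  `Q` finite and non-empty, `h m : Q → ℤ²`, `s⁺ s⁻ : Q → Q`, `N ≥ 1`.  It is impossible that at every `q ∈ Q`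
each of the four vectors `σ N eᵢ` (`i ∈ {0,1}`, `σ = ±1`) equals `h q′ − h q` for some `q′` (zero-drift slot), or `m q + (h (s⁺ q) − h q)` (forward lamp slot),
or `−m q + (h (s⁻ q) − h q)` (backward lamp slot).  (At a maximiser of `h₀`, `+N e₀` is served by a lamp slot, which forces the first coordinate of both
lamp slots off `0`; so `+N e₁` is served by a zero-drift slot landing at another maximiser of `h₀` with larger `h₁` — contradiction at a maximiser of `h₁`
among the maximisers of `h₀`.)  Lane record `P3-NILPOTENT.md` §28. [folklore] -/
theorem no_four_directions {Q : Type} [Fintype Q] [Nonempty Q] (h m : Q → Fin 2 → ℤ) (sp sm : Q → Q) (N : ℕ) (hN : 1 ≤ N)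
    (hstep : ∀ (q : Q) (i : Fin 2) (σ : ℤˣ),
      (∃ q' : Q, h q' - h q = Pi.single i ((N : ℤ) * σ)) ∨
      m q + (h (sp q) - h q) = Pi.single i ((N : ℤ) * σ) ∨
      -m q + (h (sm q) - h q) = Pi.single i ((N : ℤ) * σ)) : False := by
  classical
  have hN' : (0 : ℤ) < N := by exact_mod_cast hN
  -- a maximiser of the first coordinate
  obtain ⟨q₀, -, hq₀⟩ := Finset.exists_max_image Finset.univ (fun q : Q => h q 0) Finset.univ_nonempty
  set M : ℤ := h q₀ 0 with hM
  have hle : ∀ q : Q, h q 0 ≤ M := fun q => hq₀ q (Finset.mem_univ q)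
  -- the maximisers of `h₀`
  set Mx : Finset Q := Finset.univ.filter fun q => h q 0 = M with hMx
  have hMx_ne : Mx.Nonempty := ⟨q₀, by simp [hMx, hM]⟩
  -- KEY: at a maximiser of `h₀`, the direction `+N e₁` is served by a zero-drift slot landing in `Mx` with `h₁` raised by `N`
  have key : ∀ q ∈ Mx, ∃ q' ∈ Mx, h q' 1 = h q 1 + N := by
    intro q hq
    have hq0 : h q 0 = M := (Finset.mem_filter.1 hq).2
    -- single-coordinate readings of `Pi.single`
    have e00 : (Pi.single (0 : Fin 2) ((N : ℤ) * ((1 : ℤˣ) : ℤ)) : Fin 2 → ℤ) 0 = N := by simp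
    have e10 : (Pi.single (1 : Fin 2) ((N : ℤ) * ((1 : ℤˣ) : ℤ)) : Fin 2 → ℤ) 0 = 0 := by simp
    have e11 : (Pi.single (1 : Fin 2) ((N : ℤ) * ((1 : ℤˣ) : ℤ)) : Fin 2 → ℤ) 1 = N := by simp
    -- (1) who serves `+N e₀` at `q`?  Not a zero-drift slot; a lamp slot, pinning `m q 0`.
    have pin : (N : ℤ) ≤ m q 0 ∧ m q 0 + (h (sp q) 0 - h q 0) = N ∨
        m q 0 ≤ -(N : ℤ) ∧ -m q 0 + (h (sm q) 0 - h q 0) = N := by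
      rcases hstep q 0 1 with ⟨q', hq'⟩ | hf | hb
      · have h0 := congrFun hq' 0
        rw [Pi.sub_apply, e00] at h0
        have := hle q'
        omega
      · have h0 := congrFun hf 0
        simp only [Pi.add_apply, Pi.sub_apply] at h0
        rw [e00] at h0
        have := hle (sp q)
        exact Or.inl ⟨by omega, h0⟩
      · have h0 := congrFun hb 0
        simp only [Pi.add_apply, Pi.neg_apply, Pi.sub_apply] at h0
        rw [e00] at h0
        have := hle (sm q)
        exact Or.inr ⟨by omega, h0⟩
    -- (2) who serves `+N e₁` at `q`?  Neither lamp slot (their first coordinates are off `0`), so a zero-drift slot.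
    rcases hstep q 1 1 with ⟨q', hq'⟩ | hf | hb
    · have h0 := congrFun hq' 0
      have h1 := congrFun hq' 1
      rw [Pi.sub_apply, e10] at h0
      rw [Pi.sub_apply, e11] at h1
      refine ⟨q', Finset.mem_filter.2 ⟨Finset.mem_univ _, by omega⟩, by omega⟩
    · exfalso
      have h0 := congrFun hf 0
      simp only [Pi.add_apply, Pi.sub_apply] at h0
      rw [e10] at h0
      have := hle (sp q)
      rcases pin with ⟨h1, h2⟩ | ⟨h1, h2⟩ <;> omega
    · exfalso
      have h0 := congrFun hb 0
      simp only [Pi.add_apply, Pi.neg_apply, Pi.sub_apply] at h0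
      rw [e10] at h0
      have := hle (sm q)
      rcases pin with ⟨h1, h2⟩ | ⟨h1, h2⟩ <;> omega
  -- a maximiser of `h₁` on `Mx` is contradicted by `key`
  obtain ⟨q₁, hq₁, hmax⟩ := Finset.exists_max_image Mx (fun q : Q => h q 1) hMx_ne
  obtain ⟨q', hq', hgt⟩ := key q₁ hq₁
  have := hmax q' hq'
  omega

/-! ## §2 The reduction: one lamp letter in an abelian normal subgroup, tree letters in a torsion complement -/

section Reduction

variable {Γ : Type} [Group Γ]

/-- In a subgroup of finite index every element has a power (the factorial of the index) inside the subgroup. [folklore] -/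
theorem pow_factorial_index_mem (Γ₀ : Subgroup Γ) [Γ₀.FiniteIndex] (γ : Γ) : γ ^ (Γ₀.index).factorial ∈ Γ₀ := by
  obtain ⟨n, hn0, hnle, hn⟩ := Γ₀.exists_pow_mem_of_index_ne_zero Subgroup.FiniteIndex.index_ne_zero γ
  obtain ⟨k, hk⟩ := Nat.dvd_factorial hn0 hnle
  rw [hk, pow_mul]
  exact Γ₀.pow_mem hn k

/-- Uniqueness of the decomposition `γ = ℓ · t` (`ℓ ∈ A`, `t ∈ H`) when `A ⊓ H = ⊥`. [folklore] -/
theorem decomp_unique (A H : Subgroup Γ) (hAH : ∀ x ∈ A, x ∈ H → x = 1) {ℓ t ℓ' t' : Γ} (hℓ : ℓ ∈ A) (ht : t ∈ H)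
    (hℓ' : ℓ' ∈ A) (ht' : t' ∈ H) (he : ℓ * t = ℓ' * t') : ℓ = ℓ' ∧ t = t' := by
  -- `ℓ'⁻¹ ℓ = t' t⁻¹ ∈ A ⊓ H`
  have h1 : ℓ'⁻¹ * ℓ = t' * t⁻¹ := by
    rw [show ℓ = ℓ' * t' * t⁻¹ by rw [← he, mul_inv_cancel_right]]; group
  have h2 : ℓ'⁻¹ * ℓ = 1 := hAH _ (A.mul_mem (A.inv_mem hℓ') hℓ) (h1 ▸ H.mul_mem ht' (H.inv_mem ht))
  have hℓeq : ℓ = ℓ' := by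
    rw [inv_mul_eq_one] at h2; exact h2.symm
  refine ⟨hℓeq, ?_⟩
  rw [hℓeq] at he
  exact mul_left_cancel he

/-- **ONE-LAMP NO-GO for coset steps.**  `A ⊴ Γ` abelian, `H ≤ Γ` torsion, `A ⊓ H = ⊥`, every `γ = lam γ · tr γ` with `lam γ ∈ A`, `tr γ ∈ H`; the letters:
a finite set `S` each of whose members is a tree letter (`∈ H`) or THE lamp letter `s ∈ A`.  Then for every finite-index `Γ₀ ≤ Γ`, finite right transversal `R`
(`hRt`, `hRc` as in `CayleyCosets.conj4_of_cosetLetters`), `c : Γ₀ →* ℤ²` and `N ≥ 1`, the letter-form step condition — every representative `r` admits, for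
each axis `i` and sign `σ`, a letter `x ∈ S ∪ S⁻¹` with `r·x = a·r′`, `r′ ∈ R`, `c a = N σ eᵢ` — is FALSE.  (Reduction to §1 with `K = (index Γ₀)!`,
`C γ = c(γ^K)`, `h r = −C(lam r)`, `m r = C(r s r⁻¹)`, scale `K N`; the torsion of `H` is what makes `c a` depend on the lamp part of `a` only.  The orbit
theorem's Lipschitz condition `hlip` is not needed.)  Lane record `P3-NILPOTENT.md` §28. [folklore] -/
theorem not_cosetSteps (A H : Subgroup Γ) [A.Normal] (hA : ∀ x ∈ A, ∀ y ∈ A, x * y = y * x) (hH : ∀ t ∈ H, IsOfFinOrder t)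
    (hAH : ∀ x ∈ A, x ∈ H → x = 1) (lam tr : Γ → Γ) (hlam : ∀ γ, lam γ ∈ A) (htr : ∀ γ, tr γ ∈ H) (hdec : ∀ γ, lam γ * tr γ = γ)
    (s : Γ) (hs : s ∈ A) (S : Finset Γ) (hS : ∀ x ∈ S, x ∈ H ∨ x = s)
    (Γ₀ : Subgroup Γ) [Γ₀.FiniteIndex] (R : Finset Γ)
    (hRt : ∀ r ∈ R, ∀ r' ∈ R, ∀ a : Γ₀, (a : Γ) * r = r' → r = r') (hRc : ∀ g : Γ, ∃ a : Γ₀, ∃ r ∈ R, (a : Γ) * r = g)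
    (c : Γ₀ →* Multiplicative (Fin 2 → ℤ)) (N : ℕ) (hN : 1 ≤ N)
    (hstep : ∀ r ∈ R, ∀ (i : Fin 2) (σ : ℤˣ), ∃ x : Γ, (x ∈ S ∨ x⁻¹ ∈ S) ∧ ∃ (a : Γ₀) (r' : Γ), r' ∈ R ∧
      r * x = (a : Γ) * r' ∧ Multiplicative.toAdd (c a) = Pi.single i ((N : ℤ) * σ)) : False := by
  classical
  /- (0) the scale `K` and the scaled character `C γ = c(γ^K)` on all of `Γ` -/
  set K : ℕ := (Γ₀.index).factorial with hK
  have hKpos : 0 < K := Nat.factorial_pos _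
  have hKmem : ∀ γ : Γ, γ ^ K ∈ Γ₀ := fun γ => pow_factorial_index_mem Γ₀ γ
  let C : Γ → (Fin 2 → ℤ) := fun γ => Multiplicative.toAdd (c ⟨γ ^ K, hKmem γ⟩)
  have hC : ∀ γ : Γ, C γ = Multiplicative.toAdd (c ⟨γ ^ K, hKmem γ⟩) := fun γ => rfl
  -- `C = K • c` on `Γ₀`
  have hCΓ₀ : ∀ a : Γ₀, C a = K • Multiplicative.toAdd (c a) := by
    intro a
    have e : (⟨(a : Γ) ^ K, hKmem a⟩ : Γ₀) = a ^ K := Subtype.ext (by simp)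
    rw [hC, e]
    simp only [map_pow, toAdd_pow]
  -- `C` is invariant under conjugation by `Γ₀`
  have hCconj : ∀ (a : Γ₀) (γ : Γ), C ((a : Γ) * γ * (a : Γ)⁻¹) = C γ := by
    intro a γ
    have e : (⟨((a : Γ) * γ * (a : Γ)⁻¹) ^ K, hKmem _⟩ : Γ₀) = a * ⟨γ ^ K, hKmem γ⟩ * a⁻¹ :=
      Subtype.ext (by simp [conj_pow])
    rw [hC, hC γ, e]
    simp only [map_mul, map_inv, toAdd_mul, toAdd_inv]
    abel
  -- `C` is additive on the abelian subgroup `A`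
  have hCmul : ∀ x ∈ A, ∀ y ∈ A, C (x * y) = C x + C y := by
    intro x hx y hy
    have hc : Commute x y := hA x hx y hy
    have e : (⟨(x * y) ^ K, hKmem _⟩ : Γ₀) = ⟨x ^ K, hKmem x⟩ * ⟨y ^ K, hKmem y⟩ := Subtype.ext (hc.mul_pow K)
    rw [hC, hC x, hC y, e]
    simp only [map_mul, toAdd_mul]
  have hCone : C 1 = 0 := by
    have e : (⟨(1 : Γ) ^ K, hKmem _⟩ : Γ₀) = 1 := Subtype.ext (by simp)
    rw [hC, e, map_one, toAdd_one]
  have hCinv : ∀ x ∈ A, C x⁻¹ = -C x := by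
    intro x hx
    have e := hCmul x hx x⁻¹ (A.inv_mem hx)
    rw [mul_inv_cancel, hCone] at e
    exact eq_neg_of_add_eq_zero_right e.symm
  /- (1) the decomposition along products -/
  have hlam_mul : ∀ x y : Γ, lam (x * y) = lam x * (tr x * lam y * (tr x)⁻¹) ∧ tr (x * y) = tr x * tr y := by
    intro x y
    have hmemA : lam x * (tr x * lam y * (tr x)⁻¹) ∈ A := A.mul_mem (hlam x) (‹A.Normal›.conj_mem _ (hlam y) _)
    have he : lam (x * y) * tr (x * y) = lam x * (tr x * lam y * (tr x)⁻¹) * (tr x * tr y) := by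
      rw [hdec]
      conv_lhs => rw [← hdec x, ← hdec y]
      group
    exact decomp_unique A H hAH (hlam _) (htr _) hmemA (H.mul_mem (htr x) (htr y)) he
  -- an element of `A` is its own lamp part; a product with an element of `H` on the right keeps the lamp part
  have hlam_of_mem : ∀ x ∈ A, lam x = x := fun x hx =>
    (decomp_unique A H hAH (hlam x) (htr x) hx H.one_mem (by rw [hdec, mul_one])).1
  have hlam_mul_H : ∀ (x t : Γ), t ∈ H → lam (x * t) = lam x := by
    intro x t ht
    exact (decomp_unique A H hAH (hlam _) (htr _) (hlam x) (H.mul_mem (htr x) ht) (by rw [hdec, ← mul_assoc, hdec])).1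
  -- conjugating a lamp by the tree part of `x` is conjugating it by `x`
  have hconj_tr : ∀ (x z : Γ), z ∈ A → tr x * z * (tr x)⁻¹ = x * z * x⁻¹ := by
    intro x z hz
    have hzA : tr x * z * (tr x)⁻¹ ∈ A := ‹A.Normal›.conj_mem _ hz _
    calc tr x * z * (tr x)⁻¹ = lam x * (tr x * z * (tr x)⁻¹) * (lam x)⁻¹ := by
            rw [hA _ (hlam x) _ hzA]; group
      _ = x * z * x⁻¹ := by
            conv_rhs => rw [← hdec x]
            group
  -- `Φ(a γ) = C(lam a) + C(lam γ)` for `a ∈ Γ₀`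
  have hΦ : ∀ (a : Γ₀) (γ : Γ), C (lam ((a : Γ) * γ)) = C (lam a) + C (lam γ) := by
    intro a γ
    rw [(hlam_mul a γ).1, hCmul _ (hlam a) _ (‹A.Normal›.conj_mem _ (hlam γ) _), hconj_tr _ _ (hlam γ), hCconj]
  /- (2) `C(lam a) = K • c a` on `Γ₀` — the torsion of `H` kills the tree part -/
  have hψ : ∀ a : Γ₀, C (lam a) = K • Multiplicative.toAdd (c a) := by
    intro a
    -- the order `M ≥ 1` of the tree part
    obtain ⟨M, hMpos, hM⟩ := (hH _ (htr a)).exists_pow_eq_one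
    -- `a^M ∈ A`: the image of `a` in `Γ ⧸ A` is that of `tr a`
    have hmk : (QuotientGroup.mk (a : Γ) : Γ ⧸ A) = QuotientGroup.mk (tr a) := by
      conv_lhs => rw [← hdec (a : Γ)]
      rw [QuotientGroup.mk_mul, (QuotientGroup.eq_one_iff _).2 (hlam _), one_mul]
    have haM : ((a : Γ)) ^ M ∈ A := by
      rw [← QuotientGroup.eq_one_iff, QuotientGroup.mk_pow, hmk, ← QuotientGroup.mk_pow, hM, QuotientGroup.mk_one]
    -- `C(lam ·)` is additive on `Γ₀`, so `C(lam (a^M)) = M • C(lam a)`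
    have hpow : ∀ n : ℕ, C (lam ((a : Γ) ^ n)) = n • C (lam a) := by
      intro n
      induction n with
      | zero => rw [pow_zero, hlam_of_mem 1 A.one_mem, hCone, zero_smul]
      | succ n ih =>
        rw [pow_succ', show (a : Γ) * (a : Γ) ^ n = (a : Γ) * ((a ^ n : Γ₀) : Γ) by simp, hΦ, succ_nsmul', ← ih]
        simp
    -- compare at `a^M ∈ A`: `C(lam (a^M)) = C(a^M) = K • c(a^M) = K • M • c a`
    have h1 : C (lam ((a : Γ) ^ M)) = K • (M • Multiplicative.toAdd (c a)) := by
      rw [hlam_of_mem _ haM, show ((a : Γ)) ^ M = ((a ^ M : Γ₀) : Γ) by simp, hCΓ₀, map_pow, toAdd_pow]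
    rw [hpow, smul_comm] at h1
    -- cancel `M`
    funext i
    have h2 := congrFun h1 i
    simp only [Pi.smul_apply, nsmul_eq_mul] at h2
    have hM0 : (M : ℤ) ≠ 0 := by exact_mod_cast hMpos.ne'
    simpa [nsmul_eq_mul] using mul_left_cancel₀ hM0 h2
  /- (3) the data of §1 on `Q = R` -/
  obtain ⟨a₁, r₁, hr₁, -⟩ := hRc 1
  haveI : Nonempty ↥R := ⟨⟨r₁, hr₁⟩⟩
  -- the representative of the coset of `r y`
  have hnext : ∀ (r : ↥R) (y : Γ), ∃ r' : ↥R, ∃ a : Γ₀, (r : Γ) * y = (a : Γ) * r' := by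
    intro r y
    obtain ⟨a, r', hr', he⟩ := hRc ((r : Γ) * y)
    exact ⟨⟨r', hr'⟩, a, he.symm⟩
  choose sp spa hsp using fun r : ↥R => hnext r s
  choose sm sma hsm using fun r : ↥R => hnext r s⁻¹
  let h : ↥R → (Fin 2 → ℤ) := fun r => -C (lam r)
  let m : ↥R → (Fin 2 → ℤ) := fun r => C ((r : Γ) * s * (r : Γ)⁻¹)
  have hKN : 1 ≤ K * N := Nat.one_le_iff_ne_zero.2 (Nat.mul_ne_zero hKpos.ne' (by omega))
  -- the scaled values: `K • (N σ eᵢ) = (K N) σ eᵢ`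
  have hscale : ∀ (i : Fin 2) (σ : ℤˣ), K • (Pi.single i ((N : ℤ) * σ) : Fin 2 → ℤ) = Pi.single i (((K * N : ℕ) : ℤ) * σ) := by
    intro i σ
    ext j
    by_cases hj : j = i
    · subst hj; simp [mul_assoc]
    · simp [hj]
  -- the lamp part of `r s^{±1}` and the weight `m r`
  have hm_eq : ∀ r : ↥R, m r = C (tr r * s * (tr r)⁻¹) := fun r => by
    show C ((r : Γ) * s * (r : Γ)⁻¹) = _; rw [hconj_tr _ _ hs]
  have hlam_s : ∀ r : ↥R, C (lam ((r : Γ) * s)) = C (lam r) + m r := by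
    intro r
    have e : lam ((r : Γ) * s) = lam r * (tr r * s * (tr r)⁻¹) := by
      refine (decomp_unique A H hAH (hlam ((r : Γ) * s)) (htr ((r : Γ) * s))
        (A.mul_mem (hlam r) (‹A.Normal›.conj_mem _ hs _)) (htr r) ?_).1
      rw [hdec]
      conv_lhs => rw [← hdec (r : Γ)]
      group
    rw [e, hCmul _ (hlam r) _ (‹A.Normal›.conj_mem _ hs _), hm_eq]
  have hlam_sinv : ∀ r : ↥R, C (lam ((r : Γ) * s⁻¹)) = C (lam r) - m r := by
    intro r
    have e : lam ((r : Γ) * s⁻¹) = lam r * (tr r * s⁻¹ * (tr r)⁻¹) := by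
      refine (decomp_unique A H hAH (hlam ((r : Γ) * s⁻¹)) (htr ((r : Γ) * s⁻¹))
        (A.mul_mem (hlam r) (‹A.Normal›.conj_mem _ (A.inv_mem hs) _)) (htr r) ?_).1
      rw [hdec]
      conv_lhs => rw [← hdec (r : Γ)]
      group
    have e2 : tr r * s⁻¹ * (tr r)⁻¹ = (tr r * s * (tr r)⁻¹)⁻¹ := by group
    rw [e, hCmul _ (hlam r) _ (‹A.Normal›.conj_mem _ (A.inv_mem hs) _), e2, hCinv _ (‹A.Normal›.conj_mem _ hs _), hm_eq]
    abel
  -- representatives of the same coset coincide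
  have hrep : ∀ (r' r'' : ↥R) (a a' : Γ₀), (a : Γ) * r' = (a' : Γ) * r'' → r' = r'' := by
    intro r' r'' a a' he
    refine Subtype.ext (hRt r' r'.2 r'' r''.2 (a'⁻¹ * a) ?_)
    rw [Subgroup.coe_mul, Subgroup.coe_inv, mul_assoc, he]; group
  /- (4) feed §1 -/
  refine no_four_directions h m sp sm (K * N) hKN fun r i σ => ?_
  obtain ⟨x, hx, a, r', hr', hrx, hca⟩ := hstep r r.2 i σ
  -- the scaled value of the edge: `K • c a = C(lam (r x)) − C(lam r′)`
  have hval : K • Multiplicative.toAdd (c a) = C (lam ((r : Γ) * x)) + h ⟨r', hr'⟩ := by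
    show K • Multiplicative.toAdd (c a) = C (lam ((r : Γ) * x)) + -C (lam r')
    rw [hrx, hΦ, hψ]; abel
  rw [hca, hscale] at hval
  -- which letter?
  have hxH : x ∈ H ∨ x = s ∨ x = s⁻¹ := by
    rcases hx with hx | hx
    · rcases hS x hx with h' | h'
      · exact Or.inl h'
      · exact Or.inr (Or.inl h')
    · rcases hS x⁻¹ hx with h' | h'
      · exact Or.inl (by simpa using H.inv_mem h')
      · exact Or.inr (Or.inr (by rw [← h', inv_inv]))
  rcases hxH with hxH | hxs | hxs
  · -- tree letter: zero-drift slot to `r′`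
    refine Or.inl ⟨⟨r', hr'⟩, ?_⟩
    rw [hval, hlam_mul_H _ _ hxH]
    show -C (lam r') - -C (lam r) = _ + -C (lam r')
    abel
  · -- the lamp letter forward: `r′ = sp r`
    rw [hxs] at hrx hval
    have hr'eq : (⟨r', hr'⟩ : ↥R) = sp r := hrep _ _ a (spa r) (by rw [← hrx, hsp])
    refine Or.inr (Or.inl ?_)
    rw [← hr'eq, hval, hlam_s]
    show C ((r : Γ) * s * (r : Γ)⁻¹) + (-C (lam r') - -C (lam r)) = _ + -C (lam r')
    abel
  · -- the lamp letter backward: `r′ = sm r`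
    rw [hxs] at hrx hval
    have hr'eq : (⟨r', hr'⟩ : ↥R) = sm r := hrep _ _ a (sma r) (by rw [← hrx, hsm])
    refine Or.inr (Or.inr ?_)
    rw [← hr'eq, hval, hlam_sinv]
    show -C ((r : Γ) * s * (r : Γ)⁻¹) + (-C (lam r') - -C (lam r)) = _ + -C (lam r')
    abel

end Reduction

end OneLampNoGo

end Summit.CriticalPhenomena.PercolationContinuityZ3.Theorems.Transplant
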